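import Literature.Probability.RandomPlanarGeometry.SAWAdsorptionDesorbedPhase
import Literature.Probability.RandomPlanarGeometry.SAWAdsorptionUpperBound209
import Literature.Probability.RandomPlanarGeometry.SAWAdsorptionUpperBound207
import Literature.Probability.RandomPlanarGeometry.SAWFiniteMemory18At2688
import HarnessLib

/-!
# The adsorption window of the square lattice in one theorem: no adsorption above `μ` for `a ≤ 1`, adsorption above
# `2.69 > μ` for `a ≥ 2.09`

Topic `Literature/Probability/RandomPlanarGeometry` (a capstone leaf joining three tree files by name:
`SAWAdsorptionDesorbedPhase.lean` — `Zd.not_adsorbedAbove_of_le_one`, `Zd.AdsorbedAbove.mono`;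
`SAWAdsorptionUpperBound209.lean` — `Zd.adsorbedAbove_209`; `SAWFiniteMemory18At2688.lean` — `connectiveConstant_le_2688`,
the certified `μ(ℤ²) ≤ 2.688`).

Beaton–Guttmann–Jensen 2012 §1 (p. 2): the adsorption free energy satisfies `κ(α) = log μ` for `α < 0` and
`κ(α) ≥ max[log μ, α]`, whence `0 ≤ α_c ≤ log μ`, i.e. `1 ≤ a_c ≤ μ` (`a = e^α`; numerically `a_c = 1.77564`). In the
tree's finite language `AdsorbedAbove a Λ : ∃ K > 0, ∀ n, K Λⁿ ≤ Z⁺_n(a)` this file records the two-sided KERNEL WINDOW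
with ONE rate `Λ = 2.69` strictly above the connective constant: `Zd.adsorption_window_209`. The lower end is the printed
desorbed phase; the upper end `2.09` is the irreducible wall-returning `x`-bridge certificate (print knows no explicit
upper bound below `μ`). Axioms: standard plus the `native_decide` certificates inherited from the two computational
parents (the `AdsIrr.cert_*` census and the finite-memory bound on `μ`).
-/

namespace Literature.Probability.RandomPlanarGeometry.SAW.Zd

/-- `μ(ℤ²) < 2.69`, from the tree's certified `μ(ℤ²) ≤ 2.688` (Pönitz–Tittmann memory `18`).
[cite: PonitzTittmann2000, Table 2 (k = 18)] -/
theorem connectiveConstant_two_lt_269 : connectiveConstant 2 < 269 / 100 := by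
  have h : Literature.Probability.RandomPlanarGeometry.SAW.connectiveConstant ≤ 2.688 := connectiveConstant_le_2688
  show Literature.Probability.RandomPlanarGeometry.SAW.connectiveConstant < 269 / 100
  have h2 : (2.688 : ℝ) < 269 / 100 := by norm_num
  linarith

/-- **The adsorption window of `ℤ²`** (vertex weights, impenetrable wall): there is a rate `Λ` (namely `2.69`) with
`μ(ℤ²) < Λ` such that NO fugacity `0 ≤ a ≤ 1` is adsorbed at rate `Λ` while EVERY fugacity `a ≥ 2.09` is:
`(∀ a ∈ [0,1], ¬ AdsorbedAbove a Λ) ∧ (∀ a ≥ 2.09, AdsorbedAbove a Λ)`. In free-energy terms: `κ = log μ` on `[0, 1]`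
and `κ(a) ≥ log 2.69 > log μ` for `a ≥ 2.09`, so `1 ≤ a_c ≤ 2.09`. [cite: BeatonGuttmannJensen2012Adsorption, §1 (p. 2)] -/
theorem adsorption_window_209 :
    ∃ Λ : ℝ, connectiveConstant 2 < Λ ∧ (∀ a : ℝ, 0 ≤ a → a ≤ 1 → ¬ AdsorbedAbove a Λ) ∧
      ∀ a : ℝ, 209 / 100 ≤ a → AdsorbedAbove a Λ :=
  ⟨269 / 100, connectiveConstant_two_lt_269,
    fun _ h0 h1 => not_adsorbedAbove_of_le_one h0 h1 connectiveConstant_two_lt_269,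
    fun _ ha => adsorbedAbove_209.mono (by norm_num) ha⟩

end Literature.Probability.RandomPlanarGeometry.SAW.Zd

namespace Literature.Probability.RandomPlanarGeometry.SAW.Zd

/-- **The adsorption window of `ℤ²`, length-`20` edition**: one rate `Λ = 2.69 > μ(ℤ²)` at which no fugacity
`0 ≤ a ≤ 1` is adsorbed and every fugacity `a ≥ 2.07` is (`Zd.adsorbedAbove_207`, the census to length `20`):
`1 ≤ a_c ≤ 2.07`. [cite: BeatonGuttmannJensen2012Adsorption, §1 (p. 2)] -/
theorem adsorption_window_207 :
    ∃ Λ : ℝ, connectiveConstant 2 < Λ ∧ (∀ a : ℝ, 0 ≤ a → a ≤ 1 → ¬ AdsorbedAbove a Λ) ∧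
      ∀ a : ℝ, 207 / 100 ≤ a → AdsorbedAbove a Λ :=
  ⟨269 / 100, connectiveConstant_two_lt_269,
    fun _ h0 h1 => not_adsorbedAbove_of_le_one h0 h1 connectiveConstant_two_lt_269,
    fun _ ha => adsorbedAbove_207.mono (by norm_num) ha⟩

end Literature.Probability.RandomPlanarGeometry.SAW.Zd
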